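import Literature.AlgebraicGeometry.ModuliOfAbelianVarieties.SiegelAdmissibleMarkingUnique
import HarnessLib

/-!
# MRK-UNIQ ∕ MRK-TRANSPORT on the TORUS: the analytic uniformisation of an admissible marking is unique, and translating the period
# point by `M ∈ Γ_δ(N)` composes it with `M` ([Milne 2005] Thm. 6.11 + Lemma 5.13 + lemma of Serre; [Lange 2023] Prop. 3.1.4, Rem. 3.1.10)

Topic `Literature/AlgebraicGeometry/ModuliOfAbelianVarieties`; namespace `Literature.AlgebraicGeometry.ModuliOfAbelianVarieties.SiegelAdelicMarking`.
THEOREMS ONLY (no definition, no named fact, no instance, no `sorry`).  Sequel of ★ `SiegelAdmissibleMarkingUnique` (cell `hodgecm-mathlib`, P6 E-line organ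
E6 of crux hLiu418, ROAD MAP v2 step 5∕6; the E6 owner՚s σ1 socket pins THE admissible marking of a fibre by `γ = 1`, `Ψ = Π_Z` and reads the
`𝒪_F`-action through its torus map `toFun`).  HONEST LABEL: HC_CM is proved only modulo the 2 remaining named inputs (hLiu418 24832, h413 24833)
until rung 0 closes; this file is count-neutral.

For two admissibility data `(m, Θ, Λ)`, `(m′, Θ′, Λ′)` of the fibre `B_s` of an abelian scheme with `(D, λ, φ)` at a complex point `s` (the body of
★ `IsAdmissibleAt`, `r ∈ K_δ(1)`, `N ≥ 3`), ★ `SiegelAdmissibleMarkingUnique` gives `u = u′` on `ℚ^{2g}` at one period point and `u′ ∘ M_ℚ = u` at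
`Z′ = gDHom M • Z`.  Here the same is read on the real torus `ℝ^{2g} → (ℝ∕ℤ)^{2g} → B_s(ℂ)` (density of `ℚ^{2g}`, continuity of `toFun ∘ proj`):
* `toFun_proj_eq_toFun_proj_of_lifts` — same `Z`, same lattice frame `γ = γ′`: `toFun ∘ proj = toFun′ ∘ proj` on `ℝ^{2g}`; hence
  **`toFun_eq_toFun_of_lifts`: `toFun = toFun′` on the torus** (the carrier `(ℝ∕ℤ)^{2g}` of ★ `ComplexTorus` does not depend on `Ψ`) — «THE
  admissible marking with fixed `(r, γ)` has a unique torus map»;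
* `toFun_proj_intAct_eq_of_lifts_of_smul` — `Z′ = gDHom M • Z`, `M ∈ Γ_δ(N)`: `toFun′ [γ′⁻¹ (M x)] = toFun [γ⁻¹ x]` on `ℝ^{2g}` (★ `intAct`), and with
  `γ = γ′ = 1`: **`toFun′ (proj (intAct M x)) = toFun (proj x)`** — the admissible marking at the translated period point is the `M`-translate.

## References
* [Milne2005ShimuraVarieties] J. S. Milne, *Introduction to Shimura Varieties* (2005; rev. 2017), §6 Thm. 6.11 pp. 74–75, Lemma 5.13 p. 57 (fn. 40).
* [Lange2023AbelianVarietiesComplex] H. Lange, *Abelian Varieties over the Complex Numbers* (2023), §3.1.2 Prop. 3.1.4, §3.1.3 Remark 3.1.10 (2).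
* [MumfordFogartyKirwan1994] D. Mumford, J. Fogarty, F. Kirwan, *Geometric Invariant Theory*, 3rd ed., Ch. 7 §3 (lemma of Serre).
-/

set_option autoImplicit false

noncomputable section

open Matrix CategoryTheory AlgebraicGeometry Topology
open Literature.AlgebraicGeometry.Motives (AbelianVariety AlgPoints CartierDivisor)
open Literature.AlgebraicGeometry.AbelianSchemes (AbelianSchemeOver)
open Literature.NumberTheory.Automorphic (siegelUpperHalfSpace)
open Literature.Geometry.Kaehler (ComplexTorus)

namespace Literature.AlgebraicGeometry.ModuliOfAbelianVarieties

open SiegelModuli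

variable {g : ℕ} {δ : Fin g → ℕ} {N : ℕ} {S : Scheme} {B : AbelianSchemeOver S} {s : Spec (CommRingCat.of ℂ) ⟶ S} {D : B.DualPair}
  {lam : B.X ⟶ D.hat.X} {φ : B.LevelStructure g N} {Θ Θ' : CartierDivisor (B.fibre s).toAbelianVariety.X.left}
  {r : gspFinAdelic δ} {Z Z' : Matrix (Fin g) (Fin g) ℂ}

/-- `γ̂⁻¹_ℝ (γ̂_ℝ x) = x` for the real points of a rational frame `γ ∈ GL_{2g}(ℚ)` (plumbing). [folklore] -/
private theorem inv_map_mulVec_map_mulVec (γ : GL (Fin g ⊕ Fin g) ℚ) (x : Fin g ⊕ Fin g → ℝ) :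
    (((γ⁻¹ : GL (Fin g ⊕ Fin g) ℚ) : Matrix (Fin g ⊕ Fin g) (Fin g ⊕ Fin g) ℚ).map (algebraMap ℚ ℝ)) *ᵥ
        ((((γ : GL (Fin g ⊕ Fin g) ℚ) : Matrix (Fin g ⊕ Fin g) (Fin g ⊕ Fin g) ℚ).map (algebraMap ℚ ℝ)) *ᵥ x) = x := by
  rw [Matrix.mulVec_mulVec, ← Matrix.map_mul, Units.inv_mul, Matrix.map_one (algebraMap ℚ ℝ) (map_zero _) (map_one _),
    Matrix.one_mulVec]

/-! ### §1. MRK-UNIQ on the torus: with the same lattice frame the two torus maps are EQUAL -/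

/-- **Same period point, same frame `γ = γ′`: `toFun ∘ proj = toFun′ ∘ proj` on `ℝ^{2g}`** (★ `toFun_proj_eq_of_lifts` at `γ̂_ℝ x`).
[cite: Milne2005ShimuraVarieties, §6 Thm. 6.11 pp. 74–75; Lemma 5.13 p. 57] [cite: Lange2023AbelianVarietiesComplex, §3.1.3 Remark 3.1.10 (2)] -/
theorem SiegelAdelicMarking.toFun_proj_eq_toFun_proj_of_lifts (hg : 0 < g) (hδ : IsPolarizationType δ) (hN : 3 ≤ N)
    (hr : r ∈ principalLevelSubgroup δ 1) (hZ : Z ∈ siegelUpperHalfSpace g)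
    (m : SiegelAdelicMarking ⟨jOfSiegel δ Z, SiegelComplexRecordSystem.jOfSiegel_mem_C0pm hδ.1 hZ⟩ r (B.fibre s).toAbelianVariety)
    (Λ : φ.SymplecticLift s Θ δ) (hΘl : B.IsLambdaOfAt s D lam Θ)
    (hΛ : ∀ ⦃M : ℕ⦄, N ∣ M → M ≠ 0 → ∀ (x : Fin g ⊕ Fin g → ZMod M) (v : Fin g ⊕ Fin g → ℚ),
      AdelicCongr ((r⁻¹ : gspFinAdelic δ) : GL (Fin g ⊕ Fin g) finAdeleQ) 1 v (fun i => ((x i).val : ℚ) / M) →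
        ((Λ.lift M (Multiplicative.ofAdd x)) : (B.fibre s).toAbelianVariety.Points ℂ) = m.r v)
    (m' : SiegelAdelicMarking ⟨jOfSiegel δ Z, SiegelComplexRecordSystem.jOfSiegel_mem_C0pm hδ.1 hZ⟩ r (B.fibre s).toAbelianVariety)
    (Λ' : φ.SymplecticLift s Θ' δ) (hΘl' : B.IsLambdaOfAt s D lam Θ')
    (hΛ' : ∀ ⦃M : ℕ⦄, N ∣ M → M ≠ 0 → ∀ (x : Fin g ⊕ Fin g → ZMod M) (v : Fin g ⊕ Fin g → ℚ),
      AdelicCongr ((r⁻¹ : gspFinAdelic δ) : GL (Fin g ⊕ Fin g) finAdeleQ) 1 v (fun i => ((x i).val : ℚ) / M) →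
        ((Λ'.lift M (Multiplicative.ofAdd x)) : (B.fibre s).toAbelianVariety.Points ℂ) = m'.r v)
    (hγ : m.γ = m'.γ) (x : Fin g ⊕ Fin g → ℝ) :
    m.toFun (ComplexTorus.proj m.Ψ x) = m'.toFun (ComplexTorus.proj m'.Ψ x) := by
  have h := SiegelAdelicMarking.toFun_proj_eq_of_lifts hg hδ hN hr hZ m Λ hΘl hΛ m' Λ' hΘl' hΛ'
    ((((m.γ : GL (Fin g ⊕ Fin g) ℚ) : Matrix (Fin g ⊕ Fin g) (Fin g ⊕ Fin g) ℚ).map (algebraMap ℚ ℝ)) *ᵥ x)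
  rwa [← hγ, inv_map_mulVec_map_mulVec] at h

/-- **MRK-UNIQ on the torus — the torus map of THE admissible marking is unique**: two admissibility data of one fibre at the same `(Z, r)` with the
same lattice frame (`γ = γ′`, e.g. both `= 1`) have EQUAL analytic uniformisations `toFun = toFun′ : (ℝ∕ℤ)^{2g} → B_s(ℂ)` (the carrier of ★
`ComplexTorus Ψ` is `(ℝ∕ℤ)^{2g}` for every `Ψ`; `proj` is onto, ★ `ComplexTorus.proj_lift`).  [Milne2005ShimuraVarieties] Thm. 6.11 with the lemma of
Serre: a level-`N ≥ 3` structure kills every automorphism, so the marking is rigid.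
[cite: Milne2005ShimuraVarieties, §6 Thm. 6.11 pp. 74–75; Lemma 5.13 p. 57] [cite: MumfordFogartyKirwan1994, Ch. 7 §3 (lemma of Serre)] -/
theorem SiegelAdelicMarking.toFun_eq_toFun_of_lifts (hg : 0 < g) (hδ : IsPolarizationType δ) (hN : 3 ≤ N)
    (hr : r ∈ principalLevelSubgroup δ 1) (hZ : Z ∈ siegelUpperHalfSpace g)
    (m : SiegelAdelicMarking ⟨jOfSiegel δ Z, SiegelComplexRecordSystem.jOfSiegel_mem_C0pm hδ.1 hZ⟩ r (B.fibre s).toAbelianVariety)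
    (Λ : φ.SymplecticLift s Θ δ) (hΘl : B.IsLambdaOfAt s D lam Θ)
    (hΛ : ∀ ⦃M : ℕ⦄, N ∣ M → M ≠ 0 → ∀ (x : Fin g ⊕ Fin g → ZMod M) (v : Fin g ⊕ Fin g → ℚ),
      AdelicCongr ((r⁻¹ : gspFinAdelic δ) : GL (Fin g ⊕ Fin g) finAdeleQ) 1 v (fun i => ((x i).val : ℚ) / M) →
        ((Λ.lift M (Multiplicative.ofAdd x)) : (B.fibre s).toAbelianVariety.Points ℂ) = m.r v)
    (m' : SiegelAdelicMarking ⟨jOfSiegel δ Z, SiegelComplexRecordSystem.jOfSiegel_mem_C0pm hδ.1 hZ⟩ r (B.fibre s).toAbelianVariety)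
    (Λ' : φ.SymplecticLift s Θ' δ) (hΘl' : B.IsLambdaOfAt s D lam Θ')
    (hΛ' : ∀ ⦃M : ℕ⦄, N ∣ M → M ≠ 0 → ∀ (x : Fin g ⊕ Fin g → ZMod M) (v : Fin g ⊕ Fin g → ℚ),
      AdelicCongr ((r⁻¹ : gspFinAdelic δ) : GL (Fin g ⊕ Fin g) finAdeleQ) 1 v (fun i => ((x i).val : ℚ) / M) →
        ((Λ'.lift M (Multiplicative.ofAdd x)) : (B.fibre s).toAbelianVariety.Points ℂ) = m'.r v)
    (hγ : m.γ = m'.γ) (t : ComplexTorus m.Ψ) : m.toFun t = m'.toFun t := by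
  have h := SiegelAdelicMarking.toFun_proj_eq_toFun_proj_of_lifts hg hδ hN hr hZ m Λ hΘl hΛ m' Λ' hΘl' hΛ' hγ (ComplexTorus.lift m.Ψ t)
  rw [ComplexTorus.proj_lift] at h
  rw [h]
  exact congrArg m'.toFun (ComplexTorus.proj_lift (Φ := m'.Ψ) t)

/-! ### §2. MRK-TRANSPORT on the torus: at `Z′ = gDHom M • Z` the torus map is the `M`-translate -/

/-- **MRK-TRANSPORT on `ℝ^{2g}`**: if `Z′ = gDHom M • Z` with `M ∈ Γ_δ(N)` GIVEN, then `toFun′ [γ′⁻¹ (M x)] = toFun [γ⁻¹ x]` for every `x ∈ ℝ^{2g}`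
(★ `intAct M x = M_ℝ x`): both sides are continuous and agree on `ℚ^{2g}` by ★ `r_mulVec_eq_r_of_lifts_of_smul` (`u′(M_ℚ v) = u(v)`).
[cite: Milne2005ShimuraVarieties, §6 Thm. 6.11 pp. 74–75; Lemma 5.13 p. 57] [cite: Lange2023AbelianVarietiesComplex, §3.1.2 Prop. 3.1.4, §3.1.3 Remark 3.1.10 (2)] -/
theorem SiegelAdelicMarking.toFun_proj_intAct_eq_of_lifts_of_smul (hg : 0 < g) (hδ : IsPolarizationType δ) (hN : 3 ≤ N)
    (hr : r ∈ principalLevelSubgroup δ 1) (hZ : Z ∈ siegelUpperHalfSpace g) (hZ' : Z' ∈ siegelUpperHalfSpace g)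
    (m : SiegelAdelicMarking ⟨jOfSiegel δ Z, SiegelComplexRecordSystem.jOfSiegel_mem_C0pm hδ.1 hZ⟩ r (B.fibre s).toAbelianVariety)
    (Λ : φ.SymplecticLift s Θ δ) (hΘl : B.IsLambdaOfAt s D lam Θ)
    (hΛ : ∀ ⦃M : ℕ⦄, N ∣ M → M ≠ 0 → ∀ (x : Fin g ⊕ Fin g → ZMod M) (v : Fin g ⊕ Fin g → ℚ),
      AdelicCongr ((r⁻¹ : gspFinAdelic δ) : GL (Fin g ⊕ Fin g) finAdeleQ) 1 v (fun i => ((x i).val : ℚ) / M) →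
        ((Λ.lift M (Multiplicative.ofAdd x)) : (B.fibre s).toAbelianVariety.Points ℂ) = m.r v)
    (m' : SiegelAdelicMarking ⟨jOfSiegel δ Z', SiegelComplexRecordSystem.jOfSiegel_mem_C0pm hδ.1 hZ'⟩ r (B.fibre s).toAbelianVariety)
    (Λ' : φ.SymplecticLift s Θ' δ) (hΘl' : B.IsLambdaOfAt s D lam Θ')
    (hΛ' : ∀ ⦃M : ℕ⦄, N ∣ M → M ≠ 0 → ∀ (x : Fin g ⊕ Fin g → ZMod M) (v : Fin g ⊕ Fin g → ℚ),
      AdelicCongr ((r⁻¹ : gspFinAdelic δ) : GL (Fin g ⊕ Fin g) finAdeleQ) 1 v (fun i => ((x i).val : ℚ) / M) →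
        ((Λ'.lift M (Multiplicative.ofAdd x)) : (B.fibre s).toAbelianVariety.Points ℂ) = m'.r v)
    (M : symplecticLatticeGroup δ) (hM : (M : GL (Fin g ⊕ Fin g) ℤ) ∈ siegelLevelGroup δ N)
    (hZZ' : (⟨Z', hZ'⟩ : siegelUpperHalfSpace g) = gDHom δ hδ.1 M • ⟨Z, hZ⟩) (x : Fin g ⊕ Fin g → ℝ) :
    m'.toFun (ComplexTorus.proj m'.Ψ
        ((((m'.γ⁻¹ : GL (Fin g ⊕ Fin g) ℚ) : Matrix (Fin g ⊕ Fin g) (Fin g ⊕ Fin g) ℚ).map (algebraMap ℚ ℝ)) *ᵥ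
          intAct (M : GL (Fin g ⊕ Fin g) ℤ) x)) =
      m.toFun (ComplexTorus.proj m.Ψ
        ((((m.γ⁻¹ : GL (Fin g ⊕ Fin g) ℚ) : Matrix (Fin g ⊕ Fin g) (Fin g ⊕ Fin g) ℚ).map (algebraMap ℚ ℝ)) *ᵥ x)) := by
  -- both sides are continuous in `x` and agree on the dense rational vectors
  have hd : DenseRange (fun v : Fin g ⊕ Fin g → ℚ => fun i => (v i : ℝ)) := DenseRange.piMap fun _ => Rat.denseRange_cast
  have hF : Continuous fun y : Fin g ⊕ Fin g → ℝ => m'.toFun (ComplexTorus.proj m'.Ψ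
      ((((m'.γ⁻¹ : GL (Fin g ⊕ Fin g) ℚ) : Matrix (Fin g ⊕ Fin g) (Fin g ⊕ Fin g) ℚ).map (algebraMap ℚ ℝ)) *ᵥ
        intAct (M : GL (Fin g ⊕ Fin g) ℤ) y)) :=
    m'.isAnalytification.isHomeomorph.continuous.comp ((ComplexTorus.continuous_proj _).comp
      (continuous_const.matrix_mulVec (continuous_const.matrix_mulVec continuous_id)))
  have hG : Continuous fun y : Fin g ⊕ Fin g → ℝ => m.toFun (ComplexTorus.proj m.Ψ
      ((((m.γ⁻¹ : GL (Fin g ⊕ Fin g) ℚ) : Matrix (Fin g ⊕ Fin g) (Fin g ⊕ Fin g) ℚ).map (algebraMap ℚ ℝ)) *ᵥ y)) :=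
    m.isAnalytification.isHomeomorph.continuous.comp ((ComplexTorus.continuous_proj _).comp
      (continuous_const.matrix_mulVec continuous_id))
  -- the integer matrix `M` read over `ℚ` and over `ℝ`
  set Mq : Matrix (Fin g ⊕ Fin g) (Fin g ⊕ Fin g) ℚ :=
    (((M : GL (Fin g ⊕ Fin g) ℤ) : Matrix (Fin g ⊕ Fin g) (Fin g ⊕ Fin g) ℤ)).map (Int.castRingHom ℚ) with hMq
  have hMr : (((M : GL (Fin g ⊕ Fin g) ℤ) : Matrix (Fin g ⊕ Fin g) (Fin g ⊕ Fin g) ℤ)).map (Int.cast : ℤ → ℝ) =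
      Mq.map (algebraMap ℚ ℝ) := by
    rw [hMq, Matrix.map_map]
    exact Matrix.ext fun i j => by simp
  have hrat : ∀ v : Fin g ⊕ Fin g → ℚ, intAct (M : GL (Fin g ⊕ Fin g) ℤ) (fun i => (v i : ℝ)) = fun i => ((Mq *ᵥ v) i : ℝ) := by
    intro v
    unfold intAct
    rw [hMr]
    funext i
    exact (RingHom.map_mulVec (algebraMap ℚ ℝ) Mq v i).symm
  have hrd : ∀ {W : Matrix (Fin g) (Fin g) ℂ} {hW : W ∈ siegelUpperHalfSpace g}
      (mm : SiegelAdelicMarking ⟨jOfSiegel δ W, SiegelComplexRecordSystem.jOfSiegel_mem_C0pm hδ.1 hW⟩ r (B.fibre s).toAbelianVariety)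
      (w : Fin g ⊕ Fin g → ℚ),
      mm.toFun (ComplexTorus.proj mm.Ψ
        ((((mm.γ⁻¹ : GL (Fin g ⊕ Fin g) ℚ) : Matrix (Fin g ⊕ Fin g) (Fin g ⊕ Fin g) ℚ).map (algebraMap ℚ ℝ)) *ᵥ
          fun i => (w i : ℝ))) = mm.r w := by
    intro W hW mm w
    rw [mm.r_def]
    congr 2
    funext i
    exact (RingHom.map_mulVec (algebraMap ℚ ℝ) _ w i).symm
  refine congrFun (Continuous.ext_on hd hF hG ?_) x
  rintro _ ⟨v, rfl⟩
  change m'.toFun _ = m.toFun _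
  rw [hrat v, hrd (hW := hZ') m' (Mq *ᵥ v), hrd (hW := hZ) m v]
  exact SiegelAdelicMarking.r_mulVec_eq_r_of_lifts_of_smul hg hδ hN hr hZ hZ' m Λ hΘl hΛ m' Λ' hΘl' hΛ' M hM hZZ' v

/-- **MRK-TRANSPORT on the torus, unit frames** (`γ = γ′ = 1`, the normalisation of the E6 socket): at `Z′ = gDHom M • Z`,
`toFun′ (proj (intAct M x)) = toFun (proj x)` for every `x ∈ ℝ^{2g}` — THE admissible marking at the translated period point is the `M`-translate of
THE admissible marking at `Z`. [cite: Milne2005ShimuraVarieties, §6 Thm. 6.11 pp. 74–75] [cite: Lange2023AbelianVarietiesComplex, §3.1.2 Prop. 3.1.4] -/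
theorem SiegelAdelicMarking.toFun_proj_intAct_eq_of_lifts_of_smul_of_frame_eq_one (hg : 0 < g) (hδ : IsPolarizationType δ) (hN : 3 ≤ N)
    (hr : r ∈ principalLevelSubgroup δ 1) (hZ : Z ∈ siegelUpperHalfSpace g) (hZ' : Z' ∈ siegelUpperHalfSpace g)
    (m : SiegelAdelicMarking ⟨jOfSiegel δ Z, SiegelComplexRecordSystem.jOfSiegel_mem_C0pm hδ.1 hZ⟩ r (B.fibre s).toAbelianVariety)
    (Λ : φ.SymplecticLift s Θ δ) (hΘl : B.IsLambdaOfAt s D lam Θ)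
    (hΛ : ∀ ⦃M : ℕ⦄, N ∣ M → M ≠ 0 → ∀ (x : Fin g ⊕ Fin g → ZMod M) (v : Fin g ⊕ Fin g → ℚ),
      AdelicCongr ((r⁻¹ : gspFinAdelic δ) : GL (Fin g ⊕ Fin g) finAdeleQ) 1 v (fun i => ((x i).val : ℚ) / M) →
        ((Λ.lift M (Multiplicative.ofAdd x)) : (B.fibre s).toAbelianVariety.Points ℂ) = m.r v)
    (m' : SiegelAdelicMarking ⟨jOfSiegel δ Z', SiegelComplexRecordSystem.jOfSiegel_mem_C0pm hδ.1 hZ'⟩ r (B.fibre s).toAbelianVariety)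
    (Λ' : φ.SymplecticLift s Θ' δ) (hΘl' : B.IsLambdaOfAt s D lam Θ')
    (hΛ' : ∀ ⦃M : ℕ⦄, N ∣ M → M ≠ 0 → ∀ (x : Fin g ⊕ Fin g → ZMod M) (v : Fin g ⊕ Fin g → ℚ),
      AdelicCongr ((r⁻¹ : gspFinAdelic δ) : GL (Fin g ⊕ Fin g) finAdeleQ) 1 v (fun i => ((x i).val : ℚ) / M) →
        ((Λ'.lift M (Multiplicative.ofAdd x)) : (B.fibre s).toAbelianVariety.Points ℂ) = m'.r v)
    (M : symplecticLatticeGroup δ) (hM : (M : GL (Fin g ⊕ Fin g) ℤ) ∈ siegelLevelGroup δ N)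
    (hZZ' : (⟨Z', hZ'⟩ : siegelUpperHalfSpace g) = gDHom δ hδ.1 M • ⟨Z, hZ⟩) (hγ : m.γ = 1) (hγ' : m'.γ = 1)
    (x : Fin g ⊕ Fin g → ℝ) :
    m'.toFun (ComplexTorus.proj m'.Ψ (intAct (M : GL (Fin g ⊕ Fin g) ℤ) x)) = m.toFun (ComplexTorus.proj m.Ψ x) := by
  have h := SiegelAdelicMarking.toFun_proj_intAct_eq_of_lifts_of_smul hg hδ hN hr hZ hZ' m Λ hΘl hΛ m' Λ' hΘl' hΛ' M hM hZZ' x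
  simpa only [hγ, hγ', inv_one, Units.val_one, Matrix.map_one (algebraMap ℚ ℝ) (map_zero _) (map_one _), Matrix.one_mulVec] using h

end Literature.AlgebraicGeometry.ModuliOfAbelianVarieties

end
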